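import Summits.CriticalPhenomena.PercolationContinuityZ3.Theorems.PercNearOneGluingNoHeavyLowerTailCILOneSteiner
import HarnessLib

/-!
# `NoHeavyLowerTail` (stmt-CriticalPhenomena-4575) — the cumulative isolation lemma for an observer at the end of
# a STEINER PATH with relay hairs (iteration of the one-Steiner step)

Seat `prim-gen-swap` (gen 1), 2026-08-18.  Notation as in `…CILRelayGluing.lean` / `…CILOneSteiner.lean`.
A STEINER PATH from the observer is an injective sequence `p 0 = o, p 1, …, p k` of non-relay vertices such that
every positive-weight non-relay neighbour of `p i` (other than `p i` itself) is `p (i-1)` or `p (i+1)`; the relay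
neighbours of the `p i` are arbitrary ("hairs").

* `cil_steinerPath` — for such an observer, `μ(1 ≤ |π(o)| ≤ j) ≤ μ(|π(c)| ≤ j)` for every champion `c` of `w`, at
  every level `j`: induction on `k`, each step being the modular one-Steiner step `cil_oneSteiner_of` applied in the
  graph with the pairs at `o` closed (`pinW w {e | o ∈ e ∧ ¬ e.IsDiag} ∅`), whose observer `p 1` is again the start of
  a Steiner path (of length `k - 1`); `k = 0` is `CILOneSteiner.cil_champion_of_relayNeighbours`.
* `cil_steinerPath_exists` — the same in the `∃ a ∈ A` shape of the registered `stub_cumulativeIsolation`.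

This is the CIL analogue of the "several simple generalisations" of [KozmaNitzan2024, Thm 5 (p. 13)]; the first
configuration NOT covered is an observer (or path vertex) with TWO positive-weight Steiner neighbours — the champion-
robustness step CS(H,{x,y}) (report MAX-TRANSFER.md §SYNTHESIS on the item).
-/

noncomputable section

namespace Summit.CriticalPhenomena.PercolationContinuityZ3.Theorems

open MeasureTheory Set Literature.Probability.LatticeModels Literature.Probability.Percolation
open scoped Classical BigOperators

variable {n : ℕ}

open CILOneSteiner MergeStability RelayNbhd

/-- **CIL along a Steiner path** (all levels, champion witness).  `p : Fin (k+1) → Fin n` injective, every `p i ∉ A`,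
and every positive-weight non-relay neighbour `v ≠ p i` of `p i` is a path neighbour `p l`, `|l - i| = 1`.  Then for
the observer `o = p 0` and every champion `c` of `w`: `μ(1 ≤ |π(o)| ≤ j) ≤ μ(|π(c)| ≤ j)`. -/
theorem cil_steinerPath (A : Finset (Fin n)) (j : ℕ) :
    ∀ (k : ℕ) (w : Sym2 (Fin n) → unitInterval) (p : Fin (k + 1) → Fin n),
      Function.Injective p → (∀ i, p i ∉ A) →
      (∀ (i : Fin (k + 1)) (v : Fin n), v ∉ A → v ≠ p i → 0 < (w s(p i, v) : ℝ) →
        ∃ l : Fin (k + 1), v = p l ∧ (l.val = i.val + 1 ∨ i.val = l.val + 1)) →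
      ∀ c ∈ A, (∀ a ∈ A,
        (prodBernoulli w).real {ω : BondConfig (Fin n) | (A.filter fun z => ω ∈ openConn a z).card ≤ j} ≤
          (prodBernoulli w).real {ω : BondConfig (Fin n) | (A.filter fun z => ω ∈ openConn c z).card ≤ j}) →
      (prodBernoulli w).real {ω : BondConfig (Fin n) |
          1 ≤ (A.filter fun z => ω ∈ openConn (p 0) z).card ∧ (A.filter fun z => ω ∈ openConn (p 0) z).card ≤ j} ≤
        (prodBernoulli w).real {ω : BondConfig (Fin n) | (A.filter fun z => ω ∈ openConn c z).card ≤ j} := by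
  intro k
  induction k with
  | zero =>
    intro w p _ hpA hpath c hc hchamp
    refine cil_champion_of_relayNeighbours A (p 0) j (hpA 0) _ w rfl ?_ c hc hchamp
    intro v hv hvA
    by_contra hne
    have hpos : 0 < (w s(p 0, v) : ℝ) := lt_of_le_of_ne (w s(p 0, v)).2.1 (Ne.symm hne)
    obtain ⟨l, -, hl⟩ := hpath 0 v hvA hv hpos
    have := l.isLt
    simp only [Fin.val_zero] at hl
    omega
  | succ k ih =>
    intro w p hpinj hpA hpath c hc hchamp
    set o : Fin n := p 0 with ho'
    set x : Fin n := p 1 with hx'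
    have ho : o ∉ A := hpA 0
    have hx : x ∉ A := hpA 1
    have hxo : x ≠ o := by
      rw [hx', ho']
      intro h
      have := hpinj h
      exact absurd (congrArg Fin.val this) (by simp)
    -- the positive non-relay neighbours of `o` are `⊆ {x}`
    have hoN : ∀ v : Fin n, v ≠ o → v ∉ A → v ≠ x → (w s(o, v) : ℝ) = 0 := by
      intro v hvo hvA hvx
      by_contra hne
      have hpos : 0 < (w s(p 0, v) : ℝ) := lt_of_le_of_ne (w s(p 0, v)).2.1 (Ne.symm hne)
      obtain ⟨l, hvl, hl⟩ := hpath 0 v hvA hvo hpos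
      simp only [Fin.val_zero] at hl
      rcases hl with hl | hl
      · have hl1 : l = 1 := Fin.ext (by simp [hl])
        exact hvx (by rw [hvl, hl1])
      · omega
    -- the modular hypothesis: CIL for `x` in `G − o`, by induction along the shifted path
    refine cil_oneSteiner_of A o x j ho hx hxo _ w rfl hoN ?_ c hc hchamp
    intro c' hc' hchamp'
    set w' := pinW w {e : Sym2 (Fin n) | o ∈ e ∧ ¬ e.IsDiag} ∅ with hw'
    set p' : Fin (k + 1) → Fin n := fun i => p i.succ with hp'
    have hp'0 : p' 0 = x := by simp [hp', hx']
    have hp'inj : Function.Injective p' := fun i i' h => Fin.succ_injective _ (hpinj h)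
    have hp'A : ∀ i, p' i ∉ A := fun i => hpA i.succ
    have hpath' : ∀ (i : Fin (k + 1)) (v : Fin n), v ∉ A → v ≠ p' i → 0 < (w' s(p' i, v) : ℝ) →
        ∃ l : Fin (k + 1), v = p' l ∧ (l.val = i.val + 1 ∨ i.val = l.val + 1) := by
      intro i v hvA hvp hpos
      -- the pair is not at `o` (pairs at `o` have weight `0` in `w'`), so its weight is that of `w`
      have hio : p i.succ ≠ o := by
        rw [ho']
        intro h
        have := congrArg Fin.val (hpinj h)
        simp at this
      have hvo : v ≠ o := by
        intro hvo
        rw [hvo, hp', hw'] at hpos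
        simp only at hpos
        rw [Sym2.eq_swap, pinW_star_mk w hio] at hpos
        simp at hpos
      have hmem : s(p' i, v) ∉ {e : Sym2 (Fin n) | o ∈ e ∧ ¬ e.IsDiag} := by
        rintro ⟨hoe, -⟩
        rcases Sym2.mem_iff.1 hoe with h | h
        · exact hio h.symm
        · exact hvo h.symm
      rw [hw', pinW_apply_of_not_mem w ∅ hmem] at hpos
      obtain ⟨l, hvl, hl⟩ := hpath i.succ v hvA hvp hpos
      have hl0 : l ≠ 0 := by
        intro hl0
        rw [hl0] at hvl
        exact hvo (by rw [hvl, ho'])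
      obtain ⟨l', rfl⟩ := Fin.exists_succ_eq.2 hl0
      refine ⟨l', hvl, ?_⟩
      simp only [Fin.val_succ] at hl
      omega
    have key := ih w' p' hp'inj hp'A hpath' c' hc' hchamp'
    rw [hp'0] at key
    exact key

/-- **CIL along a Steiner path, `∃ a ∈ A` shape** of the registered `stub_cumulativeIsolation` (restricted to such
observers), `A` nonempty. -/
theorem cil_steinerPath_exists (w : Sym2 (Fin n) → unitInterval) (A : Finset (Fin n)) (j : ℕ) (hA : A.Nonempty)
    {k : ℕ} (p : Fin (k + 1) → Fin n) (hpinj : Function.Injective p) (hpA : ∀ i, p i ∉ A)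
    (hpath : ∀ (i : Fin (k + 1)) (v : Fin n), v ∉ A → v ≠ p i → 0 < (w s(p i, v) : ℝ) →
      ∃ l : Fin (k + 1), v = p l ∧ (l.val = i.val + 1 ∨ i.val = l.val + 1)) :
    ∃ a ∈ A, (prodBernoulli w).real {ω : BondConfig (Fin n) |
        1 ≤ (A.filter fun z => ω ∈ openConn (p 0) z).card ∧ (A.filter fun z => ω ∈ openConn (p 0) z).card ≤ j} ≤
      (prodBernoulli w).real {ω : BondConfig (Fin n) | (A.filter fun z => ω ∈ openConn a z).card ≤ j} := by
  obtain ⟨c, hc, hchamp⟩ := exists_champion (prodBernoulli w) A hA j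
  exact ⟨c, hc, cil_steinerPath A j k w p hpinj hpA hpath c hc hchamp⟩

end Summit.CriticalPhenomena.PercolationContinuityZ3.Theorems

end
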